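import Literature.AlgebraicGeometry.HodgeTheory.ComplexTorusIntegralHodgeClassesCorrespondenceTranspose
import Literature.AlgebraicGeometry.HodgeTheory.ComplexTorusIntegralKunnethRing
import Literature.Geometry.Kaehler.ComplexTorusCapProduct
import Literature.Geometry.Kaehler.ComplexTorusPontryaginCohomology
import Literature.Geometry.Kaehler.ComplexTorusProductFubini
import HarnessLib

/-!
# The product formula `(f × g)_*(γ ⊠ δ) = f_*γ ⊠ g_*δ` and flat base change on integral Hodge classes of complex tori

For homomorphisms `f : X → Y`, `g : Z → W` of complex tori (any relative dimensions) and integral Hodge classes `γ ∈ Hdgᵖ(X)`,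
`δ ∈ Hdg^q(Z)` we prove Fulton's product formula for the push-forward `f_* = D ∘ H_•(f) ∘ (− ∩ [X])` of g27-#2
(`integralHodgeClassesPushforward`) and the exterior product `⊠` of g27-#1 (`integralHodgeClassesCross`):

* **`integralHodgeClassesPushforward_prodMap_integralHodgeClassesCross`** — `(f × g)_*(γ ⊠ δ) = f_*γ ⊠ g_*δ`
  (Fulton, Prop. 1.10 (b) / Example 1.10.1), in the concatenated lattice frames `e_X ⊔ e_Z`, `e_Y ⊔ e_W` of the products;
* **`integralHodgeClassesPushforward_prodMap_id_pullbackHom_fstHom`**, **`…_id_prodMap_pullbackHom_sndHom`** — flat base change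
  along the projections: `(f × 1_Z)_*(pr_X^* x) = pr_Y^*(f_* x)` (Fulton, Prop. 1.7 for the square `X × Z → X`, `Y × Z → Y`);
* **`integralHodgeClassesPullbackHom_prodMap_integralHodgeClassesCross`** — `(u × v)^*(γ ⊠ δ) = u^*γ ⊠ v^*δ`.

The proof is the topological one (Brown, Chap. V §3; Hatcher §3.B; Birkenhake–Lange §2.5.3: `H_•(X, ℤ) = ⋀•Λ`, classes are
determined by periods), in three layers.

**§1 (cycles, `⋀•(Λ₁ ⊕ Λ₂)`).** `cycle_eq_of_forall_cycleIntegral_crossProduct_eq`: a cycle of `X₁ × X₂` is determined by its periods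
on the cross products `pr₁^*a ∧ pr₂^*b` of rational classes (Künneth, `iSup_range_crossHom_eq_top`). With the period formulas
`∫_{ω ∩ σ} φ = ∫_σ φ ∧ ω` (`cycleIntegral_capProduct`), `(a × b) ∪ (c × d) = ± (a ∪ c) × (b ∪ d)`
(`crossProduct_cupProduct_crossProduct`) and Fubini `∫_{σ × τ} pr₁^*α ∧ pr₂^*β = ∫_σ α · ∫_τ β` (`cycleIntegral_crossCycle`,
`cycleIntegral_crossCycle_domDomCongr_eq_zero`) this gives
`capProduct_compContinuousLinearMap_fst_crossCycle : pr₁^*ω ∩ (σ × τ) = (−1)^{|τ||ω|} (ω ∩ σ) × τ`,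
`capProduct_compContinuousLinearMap_snd_crossCycle : pr₂^*ω ∩ (σ × τ) = σ × (ω ∩ τ)` and
`capProduct_wedge_fst_snd_crossCycle : (pr₁^*γ ∧ pr₂^*δ) ∩ (σ × τ) = ± (γ ∩ σ) × (δ ∩ τ)`.

**§2 (`H_•(−, ℤ)` of `ComplexTorusCat`).** `fundamentalCycle_sumEnum : {X × Z}_{e_X ⊔ e_Z} = sign(e_X) sign(e_Z) λ_{e_X} × λ_{e_Z}`, hence
`homologyCapMap_integralHodgeClassesCross_fundamentalClass : (γ ⊠ δ) ∩ [X × Z] = (γ ∩ [X]) × (δ ∩ [Z])` (even degree kills the sign), and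
`capProduct_integralHodgeClassesPushforward_fundamentalCycle : f_*γ ∩ {Y} = H_•(f)(γ ∩ {X})` (the definition of `f_*` read
backwards, `D_Y` inverting `− ∩ [Y]`).

**§3–§4.** `(f × g)_*(γ ⊠ δ) ∩ [Y × W] = H(f × g)((γ ∩ [X]) × (δ ∩ [Z])) = H(f)(γ ∩ [X]) × H(g)(δ ∩ [Z])`
(`homologyMap_fromBlocks_crossCycle`) `= (f_*γ ∩ [Y]) × (g_*δ ∩ [W]) = (f_*γ ⊠ g_*δ) ∩ [Y × W]`, and `− ∩ [Y × W]` is injective;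
base change is the case `g = 1`, `δ = 1` (`pr_X^* x = x ⊠ 1`).

Everything is proved; no named fact is introduced (D-0026). Technical: `capProduct` needs a `LinearOrder` on the index type
(its value does not depend on it) — the statements of §1 carry instance binders, those of §2–§4 construct the orders internally;
`set_option maxSynthPendingDepth 3` as in `ComplexTorusIntegralHomologyPontryaginProduct`.

## References

* [Fulton1998] W. Fulton, *Intersection Theory*, 2nd ed., Springer (1998), §1.7 Prop. 1.7 (p0030), §1.10 Prop. 1.10 and
  Example 1.10.1 (p0035 L20–L33), Example 8.3.7 (p0133), §19.1 (p0372).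
* [Brown1982] K. S. Brown, *Cohomology of Groups*, GTM 87, Springer (1982), Chap. V §3 (cap product, p0117–p0119).
* [HatcherAT2002] A. Hatcher, *Algebraic Topology*, CUP (2002), §3.2 (p0219), §3.B (p0277 L11–L25).
* [Lange2023AbelianVarietiesComplex] H. Lange, *Abelian Varieties over the Complex Numbers*, Springer (2023), §1.1.2 (p0021),
  §2.5.3 Lemma 2.5.12, Cor. 2.5.17 (p0132–p0134), §6.2.4 (6.10) (p0310).
* [VoisinHodgeI2002] C. Voisin, *Hodge Theory and Complex Algebraic Geometry I*, CUP (2002), §11.1.2 Cor. 11.15, §11.3.3 Thm. 11.38.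
* [Bredon1993] G. Bredon, *Topology and Geometry*, GTM 139, Springer (1993), Ch. VI §11 Def. 11.2 (p0376).
-/

noncomputable section

-- Nested instance problems on the carriers `↥(rationalForms Φ k) ⊗[ℚ] ↥(rationalForms Φ' l)` (as in `ComplexTorusIntegralHomologyPontryaginProduct`).
set_option maxSynthPendingDepth 3

open CategoryTheory Opposite Module Submodule Function
open Finset.HasAntidiagonal (antidiagonal mem_antidiagonal)
open scoped TensorProduct Pointwise

namespace Literature.AlgebraicGeometry.HodgeTheory

open Literature.AlgebraicGeometry.Motives Literature.AlgebraicGeometry.Motives.HodgeStructure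
open Literature.Geometry.Kaehler Literature.Geometry.Kaehler.ComplexTorus

/-! ## §1 Cycle level: `pr₁^*ω ∩ (σ × τ) = ± (ω ∩ σ) × τ` in `⋀•(Λ₁ ⊕ Λ₂)` -/

section CapCross

variable {ι₁ ι₂ : Type} [Fintype ι₁] [Fintype ι₂] [DecidableEq ι₁] [DecidableEq ι₂] {E₁ E₂ : Type}
  [NormedAddCommGroup E₁] [NormedSpace ℂ E₁] [NormedAddCommGroup E₂] [NormedSpace ℂ E₂]
  (Φ₁ : (ι₁ → ℝ) ≃L[ℝ] E₁) (Φ₂ : (ι₂ → ℝ) ≃L[ℝ] E₂)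

omit [DecidableEq ι₁] [DecidableEq ι₂] in
/-- `pr₁^*ω ∈ Hq(X₁ × X₂, ℤ)` for `ω ∈ Hq(X₁, ℤ)`: lattice tuples of the product project to lattice tuples.
[cite: Lange2023AbelianVarietiesComplex, §1.1.2 (p0021 L5)] -/
theorem compContinuousLinearMap_fst_mem_integralForms {q : ℕ} (ω : integralForms Φ₁ q) :
    (ω : E₁ [⋀^Fin q]→L[ℝ] ℂ).compContinuousLinearMap (ContinuousLinearMap.fst ℝ E₁ E₂) ∈ integralForms (prodPeriod Φ₁ Φ₂) q := by
  intro m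
  obtain ⟨z, hz⟩ := ω.2 (fun j i ↦ m j (Sum.inl i))
  refine ⟨z, ?_⟩
  rw [ContinuousAlternatingMap.compContinuousLinearMap_apply, ← hz]
  congr 1

/-- **A cycle of `X₁ × X₂` is determined by its periods on the cross products `pr₁^*a ∧ pr₂^*b` of rational classes** (Künneth: the cross products
span `H•(X₁ × X₂, ℚ)`, A1-22 `iSup_range_crossHom_eq_top`; a cycle is determined by its rational periods, Lemma 2.5.12).
[cite: Lange2023AbelianVarietiesComplex, §2.5.3 Lemma 2.5.12 (p0133)] [cite: VoisinHodgeI2002, §11.3.3 Thm. 11.38 (p0236 L10–L16)] -/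
theorem cycle_eq_of_forall_cycleIntegral_crossProduct_eq {N : ℕ} {ρ ρ' : ⋀[ℤ]^N (ι₁ ⊕ ι₂ → ℤ)}
    (h : ∀ (k l : ℕ) (hkl : k + l = N) (a : rationalForms Φ₁ k) (b : rationalForms Φ₂ l),
      cycleIntegral (prodPeriod Φ₁ Φ₂) N ρ (crossProduct Φ₁ Φ₂ hkl a b : (E₁ × E₂) [⋀^Fin N]→L[ℝ] ℂ) =
        cycleIntegral (prodPeriod Φ₁ Φ₂) N ρ' (crossProduct Φ₁ Φ₂ hkl a b : (E₁ × E₂) [⋀^Fin N]→L[ℝ] ℂ)) :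
    ρ = ρ' := by
  haveI : HodgeTensorFacts.{0, 0} := hodgeTensorFacts_holds
  have hrat : ∀ ζ : rationalForms (prodPeriod Φ₁ Φ₂) N,
      cycleIntegral (prodPeriod Φ₁ Φ₂) N ρ (ζ : (E₁ × E₂) [⋀^Fin N]→L[ℝ] ℂ) = cycleIntegral (prodPeriod Φ₁ Φ₂) N ρ' (ζ : (E₁ × E₂) [⋀^Fin N]→L[ℝ] ℂ) := by
    intro ζ
    have hζ : ζ ∈ ⨆ kl : ↥(antidiagonal N), LinearMap.range (crossHom Φ₁ Φ₂ (mem_antidiagonal.1 kl.2)).toLinearMap := by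
      rw [iSup_range_crossHom_eq_top]
      exact Submodule.mem_top
    induction hζ using Submodule.iSup_induction' with
    | mem kl x hx =>
      obtain ⟨t, rfl⟩ := hx
      have key : ∀ t : ↥(rationalForms Φ₁ kl.1.1) ⊗[ℚ] ↥(rationalForms Φ₂ kl.1.2),
          cycleIntegral (prodPeriod Φ₁ Φ₂) N ρ ((crossHom Φ₁ Φ₂ (mem_antidiagonal.1 kl.2)).toLinearMap t : (E₁ × E₂) [⋀^Fin N]→L[ℝ] ℂ) =
            cycleIntegral (prodPeriod Φ₁ Φ₂) N ρ' ((crossHom Φ₁ Φ₂ (mem_antidiagonal.1 kl.2)).toLinearMap t : (E₁ × E₂) [⋀^Fin N]→L[ℝ] ℂ) := by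
        intro t
        induction t using TensorProduct.induction_on with
        | zero => rw [map_zero, ZeroMemClass.coe_zero, map_zero, map_zero]
        | add t t' ht ht' => rw [map_add, Submodule.coe_add, map_add, map_add, ht, ht']
        | tmul a b => rw [crossHom_tmul]; exact h _ _ _ a b
      exact key t
    | zero => rw [ZeroMemClass.coe_zero, map_zero, map_zero]
    | add x y _ _ hx hy => rw [Submodule.coe_add, map_add, map_add, hx, hy]
  letI : LinearOrder (ι₁ ⊕ ι₂) := LinearOrder.lift' (Fintype.equivFin (ι₁ ⊕ ι₂)) (Fintype.equivFin (ι₁ ⊕ ι₂)).injective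
  refine ((Pi.basisFun ℤ (ι₁ ⊕ ι₂)).exteriorPower N).ext_elem fun s ↦ ?_
  have h1 := hrat ⟨latMonomial (prodPeriod Φ₁ Φ₂) N (Set.powersetCard.ofFinEmbEquiv.symm s), latMonomial_mem_rationalForms _ N _⟩
  rw [cycleIntegral_latMonomial_eq_repr, cycleIntegral_latMonomial_eq_repr] at h1
  exact_mod_cast h1

variable [LinearOrder ι₁] [LinearOrder (ι₁ ⊕ ι₂)] {n' q m : ℕ}

/-- **`pr₁^*ω ∩ (σ × τ) = (−1)^{mq} (ω ∩ σ) × τ`** in `H_•(X₁ × X₂, ℤ) = ⋀•(Λ₁ ⊕ Λ₂)`, for `ω ∈ Hq(X₁, ℤ)`, `σ ∈ H_{n'+q}(X₁, ℤ)`, `τ ∈ H_m(X₂, ℤ)` — the cap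
product of the pulled-back class with an exterior homology product ("`(a × b) ∩ (z × w)`-naturality"): both sides have the same periods on every cross
product `pr₁^*a ∧ pr₂^*b`, namely `(−1)^{mq} ∫_σ (a ∧ ω) · ∫_τ b` in bidegree `(n', m)` and `0` otherwise (`∫_{ω ∩ ρ} φ = ∫_ρ φ ∧ ω`, `(a × b) ∪ (ω × 1) = (−1)^{|b||ω|}
(a ∪ ω) × b`, Fubini `∫_{σ × τ} pr₁^*α ∧ pr₂^*β = ∫_σ α · ∫_τ β`). [cite: Brown1982, Chap. V §3 (p0117–p0119: cap product, naturality and `⟨u ∪ v, z⟩ = ⟨u, v ∩ z⟩`)]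
[cite: Lange2023AbelianVarietiesComplex, §2.5.3 Lemma 2.5.12 (p0133)] [cite: HatcherAT2002, §3.B (p0277 L11–L25: the cross product is a ring map)] -/
theorem capProduct_compContinuousLinearMap_fst_crossCycle (h : (n' + m) + q = (n' + q) + m) (ω : integralForms Φ₁ q)
    (σ : ⋀[ℤ]^(n' + q) (ι₁ → ℤ)) (τ : ⋀[ℤ]^m (ι₂ → ℤ)) :
    capProduct (prodPeriod Φ₁ Φ₂) h
        ⟨(ω : E₁ [⋀^Fin q]→L[ℝ] ℂ).compContinuousLinearMap (ContinuousLinearMap.fst ℝ E₁ E₂), compContinuousLinearMap_fst_mem_integralForms Φ₁ Φ₂ ω⟩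
        (crossCycle σ τ) =
      ((-1 : ℤ) ^ (m * q)) • crossCycle (capProduct Φ₁ rfl ω σ) τ := by
  set ωq : rationalForms Φ₁ q := ⟨(ω : E₁ [⋀^Fin q]→L[ℝ] ℂ), mem_rationalForms_of_mem_integralForms Φ₁ ω.2⟩ with hωq
  have hω' : (ω : E₁ [⋀^Fin q]→L[ℝ] ℂ).compContinuousLinearMap (ContinuousLinearMap.fst ℝ E₁ E₂) =
      (crossProduct Φ₁ Φ₂ (Nat.add_zero q) ωq (unitClass Φ₂) : (E₁ × E₂) [⋀^Fin q]→L[ℝ] ℂ) := by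
    rw [crossProduct_unitClass_right, coe_pullbackForms_apply, realRep_fstMatrix]
  refine cycle_eq_of_forall_cycleIntegral_crossProduct_eq Φ₁ Φ₂ fun k l hkl a b ↦ ?_
  have H' : (k + q) + l = (n' + q) + m := by omega
  rw [cycleIntegral_capProduct', map_zsmul, LinearMap.smul_apply]
  change cycleIntegral (prodPeriod Φ₁ Φ₂) ((n' + q) + m) (crossCycle σ τ)
      ((((crossProduct Φ₁ Φ₂ hkl a b : rationalForms (prodPeriod Φ₁ Φ₂) (n' + m)) : (E₁ × E₂) [⋀^Fin (n' + m)]→L[ℝ] ℂ).wedge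
        ((ω : E₁ [⋀^Fin q]→L[ℝ] ℂ).compContinuousLinearMap (ContinuousLinearMap.fst ℝ E₁ E₂))).domDomCongr (finCongr h)) = _
  rw [hω', ← coe_cupProduct, crossProduct_cupProduct_crossProduct Φ₁ Φ₂ hkl (Nat.add_zero q) h rfl (Nat.add_zero l) H', cupProduct_unitClass,
    Submodule.coe_smul_of_tower, map_zsmul, coe_crossProduct, coe_crossProduct]
  by_cases hk : k = n'
  · subst hk
    obtain rfl : l = m := by omega
    rw [finCongr_refl, ContinuousAlternatingMap.domDomCongr_refl, finCongr_refl, ContinuousAlternatingMap.domDomCongr_refl, cycleIntegral_crossCycle,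
      cycleIntegral_crossCycle, coe_cupProduct, finCongr_refl, ContinuousAlternatingMap.domDomCongr_refl, cycleIntegral_capProduct]
  · rw [cycleIntegral_crossCycle_domDomCongr_eq_zero Φ₁ Φ₂ H' (by omega), cycleIntegral_crossCycle_domDomCongr_eq_zero Φ₁ Φ₂ hkl hk, smul_zero, smul_zero]

omit [DecidableEq ι₁] [DecidableEq ι₂] [LinearOrder ι₁] [LinearOrder (ι₁ ⊕ ι₂)] in
/-- `pr₂^*ω ∈ Hq(X₁ × X₂, ℤ)` for `ω ∈ Hq(X₂, ℤ)`. [cite: Lange2023AbelianVarietiesComplex, §1.1.2 (p0021 L5)] -/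
theorem compContinuousLinearMap_snd_mem_integralForms (ω : integralForms Φ₂ q) :
    (ω : E₂ [⋀^Fin q]→L[ℝ] ℂ).compContinuousLinearMap (ContinuousLinearMap.snd ℝ E₁ E₂) ∈ integralForms (prodPeriod Φ₁ Φ₂) q := by
  intro m
  obtain ⟨z, hz⟩ := ω.2 (fun j i ↦ m j (Sum.inr i))
  refine ⟨z, ?_⟩
  rw [ContinuousAlternatingMap.compContinuousLinearMap_apply, ← hz]
  congr 1

variable {n : ℕ} [LinearOrder ι₂]

omit [LinearOrder ι₁] in
/-- **`pr₂^*ω ∩ (σ × τ) = σ × (ω ∩ τ)`** (no sign: `(a × b) ∪ (1 × ω) = (a ∪ 1) × (b ∪ ω)`). [cite: Brown1982, Chap. V §3 (p0117–p0119)]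
[cite: Lange2023AbelianVarietiesComplex, §2.5.3 Lemma 2.5.12 (p0133)] [cite: HatcherAT2002, §3.B (p0277 L11–L25)] -/
theorem capProduct_compContinuousLinearMap_snd_crossCycle {m' : ℕ} (h : (n + m') + q = n + (m' + q)) (ω : integralForms Φ₂ q)
    (σ : ⋀[ℤ]^n (ι₁ → ℤ)) (τ : ⋀[ℤ]^(m' + q) (ι₂ → ℤ)) :
    capProduct (prodPeriod Φ₁ Φ₂) h
        ⟨(ω : E₂ [⋀^Fin q]→L[ℝ] ℂ).compContinuousLinearMap (ContinuousLinearMap.snd ℝ E₁ E₂), compContinuousLinearMap_snd_mem_integralForms Φ₁ Φ₂ ω⟩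
        (crossCycle σ τ) =
      crossCycle σ (capProduct Φ₂ rfl ω τ) := by
  set ωq : rationalForms Φ₂ q := ⟨(ω : E₂ [⋀^Fin q]→L[ℝ] ℂ), mem_rationalForms_of_mem_integralForms Φ₂ ω.2⟩ with hωq
  have hω' : (ω : E₂ [⋀^Fin q]→L[ℝ] ℂ).compContinuousLinearMap (ContinuousLinearMap.snd ℝ E₁ E₂) =
      (crossProduct Φ₁ Φ₂ (Nat.zero_add q) (unitClass Φ₁) ωq : (E₁ × E₂) [⋀^Fin q]→L[ℝ] ℂ) := by
    rw [crossProduct_unitClass_left, coe_pullbackForms_apply, realRep_sndMatrix]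
  refine cycle_eq_of_forall_cycleIntegral_crossProduct_eq Φ₁ Φ₂ fun k l hkl a b ↦ ?_
  have H' : k + (l + q) = n + (m' + q) := by omega
  rw [cycleIntegral_capProduct']
  change cycleIntegral (prodPeriod Φ₁ Φ₂) (n + (m' + q)) (crossCycle σ τ)
      ((((crossProduct Φ₁ Φ₂ hkl a b : rationalForms (prodPeriod Φ₁ Φ₂) (n + m')) : (E₁ × E₂) [⋀^Fin (n + m')]→L[ℝ] ℂ).wedge
        ((ω : E₂ [⋀^Fin q]→L[ℝ] ℂ).compContinuousLinearMap (ContinuousLinearMap.snd ℝ E₁ E₂))).domDomCongr (finCongr h)) = _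
  rw [hω', ← coe_cupProduct, crossProduct_cupProduct_crossProduct Φ₁ Φ₂ hkl (Nat.zero_add q) h (Nat.add_zero k) rfl H', cupProduct_unitClass, mul_zero, pow_zero,
    one_smul, coe_crossProduct, coe_crossProduct]
  by_cases hk : k = n
  · subst hk
    obtain rfl : l = m' := by omega
    rw [finCongr_refl, ContinuousAlternatingMap.domDomCongr_refl, finCongr_refl, ContinuousAlternatingMap.domDomCongr_refl, cycleIntegral_crossCycle,
      cycleIntegral_crossCycle, coe_cupProduct, finCongr_refl, ContinuousAlternatingMap.domDomCongr_refl, cycleIntegral_capProduct]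
  · rw [cycleIntegral_crossCycle_domDomCongr_eq_zero Φ₁ Φ₂ H' hk, cycleIntegral_crossCycle_domDomCongr_eq_zero Φ₁ Φ₂ hkl hk]

omit [Fintype ι₁] [DecidableEq ι₁] [DecidableEq ι₂] [LinearOrder (ι₁ ⊕ ι₂)] [Fintype ι₂] [LinearOrder ι₂] in
/-- Reindexing the class along `Fin a ≃ Fin b` does not change the cap product (bookkeeping). [cite: Brown1982, Chap. V §3 (p0117)] -/
theorem capProduct_mk_domDomCongr {ι : Type} [Fintype ι] [LinearOrder ι] {E : Type} [NormedAddCommGroup E] [NormedSpace ℂ E] (Φ : (ι → ℝ) ≃L[ℝ] E)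
    {a b c N : ℕ} (e : a = b) (h : c + b = N) (h' : c + a = N) (ω : E [⋀^Fin a]→L[ℝ] ℂ) (hω : ω.domDomCongr (finCongr e) ∈ integralForms Φ b)
    (hω' : ω ∈ integralForms Φ a) (σ : ⋀[ℤ]^N (ι → ℤ)) :
    capProduct Φ h ⟨ω.domDomCongr (finCongr e), hω⟩ σ = capProduct Φ h' ⟨ω, hω'⟩ σ := by
  subst e
  congr 2

/-- **`(pr₁^*γ ∧ pr₂^*δ) ∩ (σ × τ) = (−1)^{m′a} (γ ∩ σ) × (δ ∩ τ)`** (`m′ = |δ ∩ τ|`, `a = |γ|`): the cap product of an exterior product of classes with an exterior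
product of cycles (module law `(ω ∧ ω′) ∩ ρ = ω ∩ (ω′ ∩ ρ)` and the two one-sided formulas). [cite: Brown1982, Chap. V §3 (p0117 (3.5), p0119)]
[cite: Lange2023AbelianVarietiesComplex, §2.5.3 Lemma 2.5.12 (p0133)] -/
theorem capProduct_wedge_fst_snd_crossCycle {a b m' : ℕ} (H : (n' + m') + (a + b) = (n' + a) + (m' + b)) (γ : integralForms Φ₁ a) (δ : integralForms Φ₂ b)
    (σ : ⋀[ℤ]^(n' + a) (ι₁ → ℤ)) (τ : ⋀[ℤ]^(m' + b) (ι₂ → ℤ)) :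
    capProduct (prodPeriod Φ₁ Φ₂) H
        ⟨((γ : E₁ [⋀^Fin a]→L[ℝ] ℂ).compContinuousLinearMap (ContinuousLinearMap.fst ℝ E₁ E₂)).wedge
            ((δ : E₂ [⋀^Fin b]→L[ℝ] ℂ).compContinuousLinearMap (ContinuousLinearMap.snd ℝ E₁ E₂)),
          wedge_mem_integralForms (prodPeriod Φ₁ Φ₂) (compContinuousLinearMap_fst_mem_integralForms Φ₁ Φ₂ γ) (compContinuousLinearMap_snd_mem_integralForms Φ₁ Φ₂ δ)⟩
        (crossCycle σ τ) =
      ((-1 : ℤ) ^ (m' * a)) • crossCycle (capProduct Φ₁ rfl γ σ) (capProduct Φ₂ rfl δ τ) := by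
  rw [capProduct_wedge (prodPeriod Φ₁ Φ₂) (show (n' + m') + a = (n' + a) + m' by omega) (show ((n' + a) + m') + b = (n' + a) + (m' + b) by omega) H
      ⟨_, compContinuousLinearMap_fst_mem_integralForms Φ₁ Φ₂ γ⟩ ⟨_, compContinuousLinearMap_snd_mem_integralForms Φ₁ Φ₂ δ⟩ (crossCycle σ τ),
    capProduct_compContinuousLinearMap_snd_crossCycle, capProduct_compContinuousLinearMap_fst_crossCycle]

end CapCross

/-! ## §2 `(γ ⊠ δ) ∩ [X × Z] = (γ ∩ [X]) × (δ ∩ [Z])` and `f_*γ ∩ [Y] = f_*(γ ∩ [X])` in `H_•(−, ℤ)` -/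

namespace ComplexTorusCat

section CapCrossCat

variable (X Z : ComplexTorusCat)

/-- **`{X × Z}_{e_X ⊔ e_Z} = sign(e_X) sign(e_Z) · λ_{e_X} × λ_{e_Z}`**: the fundamental cycle of the product in the concatenated frame is the exterior
homology product of the lattice top cycles, with the product of the orientation signs (`sign(e₁ ⊔ e₂) = sign(e₁) sign(e₂)`, A1-30).
[cite: Lange2023AbelianVarietiesComplex, §2.5.3 Cor. 2.5.17 (a) (p0134)] [cite: VoisinHodgeI2002, §11.1.2 Cor. 11.15] -/
theorem fundamentalCycle_sumEnum {nX nZ : ℕ} (eX : Fin nX ≃ X.toIsog.ι) (eZ : Fin nZ ≃ Z.toIsog.ι) :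
    fundamentalCycle (prodObj X Z).toIsog.Φ (sumEnum eX eZ) =
      (orientationSign X.toIsog.Φ eX * orientationSign Z.toIsog.Φ eZ) • crossCycle (latCycle ⇑eX) (latCycle ⇑eZ) := by
  have happ : (⇑(sumEnum eX eZ) : Fin (nX + nZ) → X.toIsog.ι ⊕ Z.toIsog.ι) = Fin.append (Sum.inl ∘ ⇑eX) (Sum.inr ∘ ⇑eZ) := by
    funext x
    refine Fin.addCases (fun i ↦ ?_) (fun j ↦ ?_) x
    · rw [Fin.append_left, sumEnum_castAdd, Function.comp_apply]
    · rw [Fin.append_right, sumEnum_natAdd, Function.comp_apply]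
  rw [fundamentalCycle_eq, crossCycle_latCycle, ← happ]
  exact congrArg (fun s : ℤ ↦ s • latCycle (⇑(sumEnum eX eZ))) (orientationSign_sumEnum_eq_mul X.toIsog.Φ Z.toIsog.Φ eX eZ)

variable [LinearOrder X.toIsog.ι] [LinearOrder Z.toIsog.ι]

/-- **`(γ ⊠ δ) ∩ [X × Z] = (γ ∩ [X]) × (δ ∩ [Z])` in `H_{l_X + l_Z}(X × Z, ℤ)`** for integral Hodge classes `γ ∈ Hdgᵖ(X)`, `δ ∈ Hdg^q(Z)` (`l_X + 2p = rk Λ_X`,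
`l_Z + 2q = rk Λ_Z`), the fundamental class of the product taken in the concatenated frame: the cap product of an exterior product with the exterior
homology product `[X × Z] = [X] × [Z]` (`fundamentalCycle_sumEnum`) factors (`capProduct_wedge_fst_snd_crossCycle`; the sign `(−1)^{l_Z · 2p} = 1`).
[cite: Brown1982, Chap. V §3 (p0117–p0119)] [cite: Lange2023AbelianVarietiesComplex, §2.5.3 Lemma 2.5.12, Cor. 2.5.17 (p0133–p0134)] [cite: Fulton1998, §1.10 (p0035 L20–L29: exterior products)] -/
theorem homologyCapMap_integralHodgeClassesCross_fundamentalClass {nX nZ lX lZ p q r : ℕ} (eX : Fin nX ≃ X.toIsog.ι) (eZ : Fin nZ ≃ Z.toIsog.ι)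
    (hX : lX + 2 * p = nX) (hZ : lZ + 2 * q = nZ) (hpq : p + q = r) (hXZ : (lX + lZ) + 2 * r = nX + nZ)
    (γ : integralHodgeClasses X.toIsog.Φ p) (δ : integralHodgeClasses Z.toIsog.Φ q) :
    homologyCapMap (prodObj X Z) hXZ
        (((intHodgeClassesAddEquivIntegralHodgeClasses (prodObj X Z) r).symm (integralHodgeClassesCross X Z hpq γ δ) :
            (HkIntObj (prodObj X Z) (2 * r)).intHodgeClasses r) : rationalForms (prodObj X Z).toIsog.Φ (2 * r))
        ((fundamentalClass (prodObj X Z) (sumEnum eX eZ) : (HₖIntObj (prodObj X Z) (nX + nZ)).Λ) : (HₖIntObj (prodObj X Z) (nX + nZ)).V) =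
      ((cyclePeriod (prodObj X Z) (lX + lZ)
          (crossCycle
            (capProduct X.toIsog.Φ hX ⟨(γ : X.toIsog.E [⋀^Fin (2 * p)]→L[ℝ] ℂ), ((mem_integralHodgeClassesIn_iff_mem_hodgeClassesIn X.toIsog.Φ).1 γ.2).2⟩
              (fundamentalCycle X.toIsog.Φ eX))
            (capProduct Z.toIsog.Φ hZ ⟨(δ : Z.toIsog.E [⋀^Fin (2 * q)]→L[ℝ] ℂ), ((mem_integralHodgeClassesIn_iff_mem_hodgeClassesIn Z.toIsog.Φ).1 δ.2).2⟩
              (fundamentalCycle Z.toIsog.Φ eZ))) : (HₖIntObj (prodObj X Z) (lX + lZ)).Λ) : (HₖIntObj (prodObj X Z) (lX + lZ)).V) := by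
  letI iXZ : LinearOrder (X.toIsog.ι ⊕ Z.toIsog.ι) :=
    LinearOrder.lift' (Fintype.equivFin (X.toIsog.ι ⊕ Z.toIsog.ι)) (Fintype.equivFin (X.toIsog.ι ⊕ Z.toIsog.ι)).injective
  letI : LinearOrder (prodObj X Z).toIsog.ι := iXZ
  subst hX hZ
  have hv : (((intHodgeClassesAddEquivIntegralHodgeClasses (prodObj X Z) r).symm (integralHodgeClassesCross X Z hpq γ δ) :
      (HkIntObj (prodObj X Z) (2 * r)).intHodgeClasses r) : rationalForms (prodObj X Z).toIsog.Φ (2 * r)) ∈ integralKForms (prodObj X Z).toIsog.Φ (2 * r) :=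
    (mem_integralKForms_iff _ _).2 ((mem_integralHodgeClassesIn_iff_mem_hodgeClassesIn (prodObj X Z).toIsog.Φ).1 (integralHodgeClassesCross X Z hpq γ δ).2).2
  have hw : ((γ : X.toIsog.E [⋀^Fin (2 * p)]→L[ℝ] ℂ).compContinuousLinearMap (ContinuousLinearMap.fst ℝ X.toIsog.E Z.toIsog.E)).wedge
      ((δ : Z.toIsog.E [⋀^Fin (2 * q)]→L[ℝ] ℂ).compContinuousLinearMap (ContinuousLinearMap.snd ℝ X.toIsog.E Z.toIsog.E)) ∈
        integralForms (prodObj X Z).toIsog.Φ (2 * p + 2 * q) :=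
    wedge_mem_integralForms (prodPeriod X.toIsog.Φ Z.toIsog.Φ) (compContinuousLinearMap_fst_mem_integralForms X.toIsog.Φ Z.toIsog.Φ ⟨_, ((mem_integralHodgeClassesIn_iff_mem_hodgeClassesIn X.toIsog.Φ).1 γ.2).2⟩)
      (compContinuousLinearMap_snd_mem_integralForms X.toIsog.Φ Z.toIsog.Φ ⟨_, ((mem_integralHodgeClassesIn_iff_mem_hodgeClassesIn Z.toIsog.Φ).1 δ.2).2⟩)
  have hmk : (⟨((((intHodgeClassesAddEquivIntegralHodgeClasses (prodObj X Z) r).symm (integralHodgeClassesCross X Z hpq γ δ) :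
      (HkIntObj (prodObj X Z) (2 * r)).intHodgeClasses r) : rationalForms (prodObj X Z).toIsog.Φ (2 * r)) : (X.toIsog.E × Z.toIsog.E) [⋀^Fin (2 * r)]→L[ℝ] ℂ), hv⟩ :
        integralForms (prodObj X Z).toIsog.Φ (2 * r)) =
      ⟨(((γ : X.toIsog.E [⋀^Fin (2 * p)]→L[ℝ] ℂ).compContinuousLinearMap (ContinuousLinearMap.fst ℝ X.toIsog.E Z.toIsog.E)).wedge
          ((δ : Z.toIsog.E [⋀^Fin (2 * q)]→L[ℝ] ℂ).compContinuousLinearMap (ContinuousLinearMap.snd ℝ X.toIsog.E Z.toIsog.E))).domDomCongr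
          (finCongr (by omega : 2 * p + 2 * q = 2 * r)), by rw [← coe_integralHodgeClassesCross X Z hpq γ δ]; exact hv⟩ :=
    Subtype.ext (coe_integralHodgeClassesCross X Z hpq γ δ)
  rw [fundamentalClass_def, homologyCapMap_cyclePeriod (prodObj X Z) hXZ hv, hmk,
    capProduct_mk_domDomCongr _ (by omega : 2 * p + 2 * q = 2 * r) hXZ (by omega) _ _ hw, fundamentalCycle_sumEnum, capProduct_zsmul_right]
  erw [capProduct_wedge_fst_snd_crossCycle X.toIsog.Φ Z.toIsog.Φ (by omega : (lX + lZ) + (2 * p + 2 * q) = (lX + 2 * p) + (lZ + 2 * q))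
    ⟨_, ((mem_integralHodgeClassesIn_iff_mem_hodgeClassesIn X.toIsog.Φ).1 γ.2).2⟩ ⟨_, ((mem_integralHodgeClassesIn_iff_mem_hodgeClassesIn Z.toIsog.Φ).1 δ.2).2⟩
    (latCycle ⇑eX) (latCycle ⇑eZ)]
  rw [((even_two_mul p).mul_left lZ).neg_one_pow, one_smul, fundamentalCycle_eq, fundamentalCycle_eq, capProduct_zsmul_right, capProduct_zsmul_right,
    crossCycle_smul_left, crossCycle_smul_right, smul_smul]

end CapCrossCat

section PushforwardCap

variable {X Y : ComplexTorusCat} (f : X ⟶ Y) {n n' l p p' g g' : ℕ} (eX : Fin n ≃ X.toIsog.ι) (eY : Fin n' ≃ Y.toIsog.ι)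
  (hX : l + 2 * p = n) (hg : g + g = n) (hY : l + 2 * p' = n') (hg' : g' + g' = n')

/-- **`f_*γ ∩ [Y] = f_*(γ ∩ [X])`** in `H_l(Y, ℤ)` (the definition `f_* = D_Y ∘ H_l(f) ∘ (− ∩ [X])` read backwards: `D_Y` inverts `− ∩ [Y]`).
[cite: Bredon1993, Ch. VI §11 Def. 11.2 (p0376 L18)] [cite: Fulton1998, §19.1 (p0372 L26–L30)] -/
theorem homologyCapMap_integralHodgeClassesPushforward_fundamentalClass (γ : integralHodgeClasses X.toIsog.Φ p) :
    homologyCapMap Y hY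
        (((intHodgeClassesAddEquivIntegralHodgeClasses Y p').symm (integralHodgeClassesPushforward p p' f eX eY hX hg hY hg' γ) :
            (HkIntObj Y (2 * p')).intHodgeClasses p') : rationalForms Y.toIsog.Φ (2 * p'))
        ((fundamentalClass Y eY : (HₖIntObj Y n').Λ) : (HₖIntObj Y n').V) =
      (HₖIntMap f l).hom.toLinearMap
        (homologyCapMap X hX (((intHodgeClassesAddEquivIntegralHodgeClasses X p).symm γ : (HkIntObj X (2 * p)).intHodgeClasses p) :
            rationalForms X.toIsog.Φ (2 * p)) ((fundamentalClass X eX : (HₖIntObj X n).Λ) : (HₖIntObj X n).V)) := by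
  rw [coe_addEquiv_symm_integralHodgeClassesPushforward, homologyCapMap_poincareInverse_fundamentalClass]

/-- **`f_*γ ∩ {Y} = H_l(f)(γ ∩ {X})` at the level of cycles** (`{−}` the fundamental cycles in the frames `e_X`, `e_Y`): the previous identity read through
the period isomorphism `⋀_l Λ ≅ H_l(−, ℤ)` (`homologyCapMap_cyclePeriod`, `HₖIntMap_cyclePeriod`, injectivity of periods).
[cite: Bredon1993, Ch. VI §11 Def. 11.2 (p0376 L18)] [cite: Lange2023AbelianVarietiesComplex, §2.5.3 Lemma 2.5.12 (p0133)] -/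
theorem capProduct_integralHodgeClassesPushforward_fundamentalCycle [LinearOrder X.toIsog.ι] [LinearOrder Y.toIsog.ι] (γ : integralHodgeClasses X.toIsog.Φ p) :
    capProduct Y.toIsog.Φ hY
        ⟨((integralHodgeClassesPushforward p p' f eX eY hX hg hY hg' γ : integralHodgeClasses Y.toIsog.Φ p') : Y.toIsog.E [⋀^Fin (2 * p')]→L[ℝ] ℂ),
          ((mem_integralHodgeClassesIn_iff_mem_hodgeClassesIn Y.toIsog.Φ).1 (integralHodgeClassesPushforward p p' f eX eY hX hg hY hg' γ).2).2⟩
        (fundamentalCycle Y.toIsog.Φ eY) =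
      homologyMap f.1 l
        (capProduct X.toIsog.Φ hX ⟨(γ : X.toIsog.E [⋀^Fin (2 * p)]→L[ℝ] ℂ), ((mem_integralHodgeClassesIn_iff_mem_hodgeClassesIn X.toIsog.Φ).1 γ.2).2⟩
          (fundamentalCycle X.toIsog.Φ eX)) := by
  have h1 := homologyCapMap_integralHodgeClassesPushforward_fundamentalClass f eX eY hX hg hY hg' γ
  have hvY : (((intHodgeClassesAddEquivIntegralHodgeClasses Y p').symm (integralHodgeClassesPushforward p p' f eX eY hX hg hY hg' γ) :
      (HkIntObj Y (2 * p')).intHodgeClasses p') : rationalForms Y.toIsog.Φ (2 * p')) ∈ integralKForms Y.toIsog.Φ (2 * p') :=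
    (mem_integralKForms_iff _ _).2 ((mem_integralHodgeClassesIn_iff_mem_hodgeClassesIn Y.toIsog.Φ).1 (integralHodgeClassesPushforward p p' f eX eY hX hg hY hg' γ).2).2
  have hvX : (((intHodgeClassesAddEquivIntegralHodgeClasses X p).symm γ : (HkIntObj X (2 * p)).intHodgeClasses p) : rationalForms X.toIsog.Φ (2 * p)) ∈
      integralKForms X.toIsog.Φ (2 * p) :=
    (mem_integralKForms_iff _ _).2 ((mem_integralHodgeClassesIn_iff_mem_hodgeClassesIn X.toIsog.Φ).1 γ.2).2
  rw [fundamentalClass_def, fundamentalClass_def, homologyCapMap_cyclePeriod Y hY hvY, homologyCapMap_cyclePeriod X hX hvX, HₖIntMap_cyclePeriod] at h1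
  exact cyclePeriod_injective Y l (Subtype.coe_injective h1)

end PushforwardCap

/-! ## §3 The product formula `(f × g)_*(γ ⊠ δ) = f_*γ ⊠ g_*δ` -/

section ProductFormula

variable {X Y Z W : ComplexTorusCat} (f : X ⟶ Y) (g : Z ⟶ W) {nX nY nZ nW lX lZ p p' q q' r r' gX gY gZ gW G G' : ℕ}
  (eX : Fin nX ≃ X.toIsog.ι) (eY : Fin nY ≃ Y.toIsog.ι) (eZ : Fin nZ ≃ Z.toIsog.ι) (eW : Fin nW ≃ W.toIsog.ι)
  (hX : lX + 2 * p = nX) (hgX : gX + gX = nX) (hY : lX + 2 * p' = nY) (hgY : gY + gY = nY)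
  (hZ : lZ + 2 * q = nZ) (hgZ : gZ + gZ = nZ) (hW : lZ + 2 * q' = nW) (hgW : gW + gW = nW)
  (hpq : p + q = r) (hp'q' : p' + q' = r') (hXZ : (lX + lZ) + 2 * r = nX + nZ) (hG : G + G = nX + nZ) (hYW : (lX + lZ) + 2 * r' = nY + nW)
  (hG' : G' + G' = nY + nW)

/-- **The product formula `(f × g)_*(γ ⊠ δ) = f_*γ ⊠ g_*δ`** on integral Hodge classes of complex tori, for arbitrary homomorphisms `f : X → Y`, `g : Z → W`
(any relative dimensions) — Fulton Prop. 1.10 (b)(i) / Example 1.10.1 for proper push-forward of exterior products ("if `f`, `g` are proper, … `f × g`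
is proper, with `(f × g)_*(α × β) = f_*α × g_*β`"), here for the push-forward `f_* = D_Y ∘ H_•(f) ∘ (− ∩ [X])` on `Hdg•(−, ℤ)`: cap with
`[X × Z] = [X] × [Z]` factors (`homologyCapMap_integralHodgeClassesCross_fundamentalClass`), `H_•(f × g)(σ × τ) = H_•(f)σ × H_•(g)τ`
(`homologyMap_fromBlocks_crossCycle`), and `D_{Y×W}` is recovered from `− ∩ [Y × W]`. The frames of the products are the concatenated ones (the
push-forward does not depend on them, `integralHodgeClassesPushforward_eq_of_enum`).
[cite: Fulton1998, §1.10 Prop. 1.10 (b) and Example 1.10.1 (p0035 L20–L33)] [cite: Brown1982, Chap. V §3 (p0117–p0119)] [cite: Lange2023AbelianVarietiesComplex, §2.5.3 (p0132–p0134)] -/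
theorem integralHodgeClassesPushforward_prodMap_integralHodgeClassesCross (γ : integralHodgeClasses X.toIsog.Φ p) (δ : integralHodgeClasses Z.toIsog.Φ q) :
    integralHodgeClassesPushforward r r' (prodMap f g) (sumEnum eX eZ) (sumEnum eY eW) hXZ hG hYW hG' (integralHodgeClassesCross X Z hpq γ δ) =
      integralHodgeClassesCross Y W hp'q' (integralHodgeClassesPushforward p p' f eX eY hX hgX hY hgY γ)
        (integralHodgeClassesPushforward q q' g eZ eW hZ hgZ hW hgW δ) := by
  letI : LinearOrder X.toIsog.ι := LinearOrder.lift' (Fintype.equivFin X.toIsog.ι) (Fintype.equivFin X.toIsog.ι).injective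
  letI : LinearOrder Y.toIsog.ι := LinearOrder.lift' (Fintype.equivFin Y.toIsog.ι) (Fintype.equivFin Y.toIsog.ι).injective
  letI : LinearOrder Z.toIsog.ι := LinearOrder.lift' (Fintype.equivFin Z.toIsog.ι) (Fintype.equivFin Z.toIsog.ι).injective
  letI : LinearOrder W.toIsog.ι := LinearOrder.lift' (Fintype.equivFin W.toIsog.ι) (Fintype.equivFin W.toIsog.ι).injective
  apply (intHodgeClassesAddEquivIntegralHodgeClasses (prodObj Y W) r').symm.injective
  apply Subtype.ext
  rw [coe_addEquiv_symm_integralHodgeClassesPushforward, homologyCapMap_integralHodgeClassesCross_fundamentalClass X Z eX eZ hX hZ hpq hXZ γ δ,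
    HₖIntMap_cyclePeriod, prodMap_val, homologyMap_fromBlocks_crossCycle,
    ← capProduct_integralHodgeClassesPushforward_fundamentalCycle f eX eY hX hgX hY hgY γ,
    ← capProduct_integralHodgeClassesPushforward_fundamentalCycle g eZ eW hZ hgZ hW hgW δ,
    ← homologyCapMap_integralHodgeClassesCross_fundamentalClass Y W eY eW hY hW hp'q' hYW, poincareInverse_homologyCapMap_fundamentalClass]

end ProductFormula

/-! ## §4 Pull-back of exterior products; flat base change along projections -/

section BaseChange

variable {X Y Z W : ComplexTorusCat}

/-- **`(u × v)^*(γ ⊠ δ) = u^*γ ⊠ v^*δ`** (naturality of the exterior product under pull-back: `pr₁ ∘ (u × v) = u ∘ pr₁`, `pr₂ ∘ (u × v) = v ∘ pr₂`, and `^*` is a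
ring map). [cite: Fulton1998, §1.10 Example 1.10.1 / Example 8.3.7 (p0035, p0133 L30)] [cite: HatcherAT2002, §3.2 (p0219: naturality of cross product)] -/
theorem integralHodgeClassesPullbackHom_prodMap_integralHodgeClassesCross (u : X ⟶ Y) (v : Z ⟶ W) {p q r : ℕ} (hpq : p + q = r)
    (γ : integralHodgeClasses Y.toIsog.Φ p) (δ : integralHodgeClasses W.toIsog.Φ q) :
    integralHodgeClassesPullbackHom (prodMap u v) r (integralHodgeClassesCross Y W hpq γ δ) =
      integralHodgeClassesCross X Z hpq (integralHodgeClassesPullbackHom u p γ) (integralHodgeClassesPullbackHom v q δ) := by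
  rw [integralHodgeClassesCross_apply, integralHodgeClassesCross_apply, integralHodgeClassesPullbackHom_cup, ← integralHodgeClassesPullbackHom_comp,
    ← integralHodgeClassesPullbackHom_comp, prodMap_fstHom, prodMap_sndHom, integralHodgeClassesPullbackHom_comp, integralHodgeClassesPullbackHom_comp]

variable (f : X ⟶ Y) (Z) {nX nY nZ lX p p' gX gY G G' : ℕ} (eX : Fin nX ≃ X.toIsog.ι) (eY : Fin nY ≃ Y.toIsog.ι) (eZ : Fin nZ ≃ Z.toIsog.ι)
  (hX : lX + 2 * p = nX) (hgX : gX + gX = nX) (hY : lX + 2 * p' = nY) (hgY : gY + gY = nY)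

/-- **Flat base change along a projection: `(f × 1_Z)_*(pr_X^* x) = pr_Y^*(f_* x)`** in `Hdg•(Y × Z, ℤ)`, for the cartesian square
`X × Z → X`, `Y × Z → Y` (Fulton Prop. 1.7: "`g` flat, `f` proper ⇒ `g'^* f_* α = f'_* g^* α`"), any homomorphism `f : X → Y` of complex tori: the case
`δ = 1_Z`, `g = 1_Z` of the product formula (`pr_X^* x = x ⊠ 1_Z`, `(1_Z)_* 1_Z = 1_Z`).
[cite: Fulton1998, §1.7 Prop. 1.7 (p0030) and §1.10 Example 1.10.1 (p0035)] [cite: Lange2023AbelianVarietiesComplex, §6.2.4 (6.10) (p0310 L33–L35)] -/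
theorem integralHodgeClassesPushforward_prodMap_id_pullbackHom_fstHom (hXZ : (lX + nZ) + 2 * p = nX + nZ) (hG : G + G = nX + nZ)
    (hYZ : (lX + nZ) + 2 * p' = nY + nZ) (hG' : G' + G' = nY + nZ) (x : integralHodgeClasses X.toIsog.Φ p) :
    integralHodgeClassesPushforward p p' (prodMap f (𝟙 Z)) (sumEnum eX eZ) (sumEnum eY eZ) hXZ hG hYZ hG' (integralHodgeClassesPullbackHom (fstHom X Z) p x) =
      integralHodgeClassesPullbackHom (fstHom Y Z) p' (integralHodgeClassesPushforward p p' f eX eY hX hgX hY hgY x) := by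
  have hgZ : (G - gX) + (G - gX) = nZ := by omega
  rw [← integralHodgeClassesCross_unitIntegralHodgeClass_right, ← integralHodgeClassesCross_unitIntegralHodgeClass_right,
    integralHodgeClassesPushforward_prodMap_integralHodgeClassesCross f (𝟙 Z) eX eY eZ eZ hX hgX hY hgY (by omega) hgZ (by omega) hgZ (Nat.add_zero p)
      (Nat.add_zero p') hXZ hG hYZ hG',
    integralHodgeClassesPushforward_id]

/-- **Flat base change along a projection, second factor: `(1_Z × f)_*(pr_X^* x) = pr_Y^*(f_* x)`** in `Hdg•(Z × Y, ℤ)`.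
[cite: Fulton1998, §1.7 Prop. 1.7 (p0030) and §1.10 Example 1.10.1 (p0035)] [cite: Lange2023AbelianVarietiesComplex, §6.2.4 (6.10) (p0310 L33–L35)] -/
theorem integralHodgeClassesPushforward_id_prodMap_pullbackHom_sndHom (hZX : (nZ + lX) + 2 * p = nZ + nX) (hG : G + G = nZ + nX)
    (hZY : (nZ + lX) + 2 * p' = nZ + nY) (hG' : G' + G' = nZ + nY) (x : integralHodgeClasses X.toIsog.Φ p) :
    integralHodgeClassesPushforward p p' (prodMap (𝟙 Z) f) (sumEnum eZ eX) (sumEnum eZ eY) hZX hG hZY hG' (integralHodgeClassesPullbackHom (sndHom Z X) p x) =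
      integralHodgeClassesPullbackHom (sndHom Z Y) p' (integralHodgeClassesPushforward p p' f eX eY hX hgX hY hgY x) := by
  have hgZ : (G - gX) + (G - gX) = nZ := by omega
  rw [← integralHodgeClassesCross_unitIntegralHodgeClass_left, ← integralHodgeClassesCross_unitIntegralHodgeClass_left,
    integralHodgeClassesPushforward_prodMap_integralHodgeClassesCross (𝟙 Z) f eZ eZ eX eY (by omega) hgZ (by omega) hgZ hX hgX hY hgY (Nat.zero_add p)
      (Nat.zero_add p') hZX hG hZY hG',
    integralHodgeClassesPushforward_id]

end BaseChange

end ComplexTorusCat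

end Literature.AlgebraicGeometry.HodgeTheory
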